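import Mathlib
import Summits.KontsevichZagierPeriods.KontsevichZagierPeriods.Theorems.SoloInformedHookBase
import Summits.KontsevichZagierPeriods.KontsevichZagierPeriods.Theorems.SoloInformedHookShuffle
import HarnessLib
import HarnessLib.Audit

/-!
# SoloInformed — the hook identities: shuffle form, counting form, first instances (LIII, F6b)

Solo programme `solo-KontsevichZagierPeriods-informed`, session s54.  THEOREM LIII
(`soloInformed_hook_identity`, file `SoloInformedHookBase`) in SHUFFLE FORM — for every
admissible `u` of weight `m + 1` and every `i`,
  `Σ_{w ∈ bw(u)⁻ ш 1^{i+1}} Z(0 :: w) = Σ_{v ∈ HookWords u 0 (i+1)} Z(v)`  in `𝒫`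
(`soloInformed_hook_identity_shuffle`, via file `SoloInformedHookShuffle`) — in
KANEKO–YAMAMOTO FORM (§3, `soloInformed_KY_integral_series_ones`, via file
`SoloInformedHookSeries`): for `u = a :: T`,
  `Σ_{w ∈ bw(u)⁻ ш 1^{i+1}} Z(0 :: w) = Σ_{d ⊨ i+2} Σ_{v ∈ T ∗ d.tail} Z((a − 1 + d_1) :: v)`,
literally `Z(μ(k,(1^{i+2}))) = Z(k ⊛ ((1^{i+2}))^★)` for `k = (rev T, a − 1)`, i.e. K–Y's
integral–series identity (their Thm 4.1) for ALL pairs `(k, (1,…,1))` — in COUNTING FORM —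
`Σ_{w} #{σ ⊨ E | idx_σ = w} · Z(w) =
Σ_{v ∈ HookWords u 0 (i+1)} Z(v)` — and its first instances in Kontsevich's formal period ring
`𝒫`, all multiplicities and word lists computed by `decide`:

* `u = (2)`, one bullet:  `2·Z(2,1) = Z(2,1) + Z(3)` (whence Euler's `Z(2,1) = Z(3)`, in the tree as
  `soloInformed_mzvClass_euler3`);
* `u = (2)`, two bullets: `3·Z(2,1,1) = Z(2,1,1) + Z(2,2) + Z(3,1) + Z(4)`;
* `u = (3)`, one bullet:  `Z(2,2) + 2·Z(3,1) = Z(3,1) + Z(4)`, hence `Z(2,2) + Z(3,1) = Z(4)`;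
* `u = (2,1)`, one bullet: `3·Z(2,1,1) = 2·Z(2,1,1) + Z(2,2) + Z(3,1)`, hence
  `Z(2,1,1) = Z(2,2) + Z(3,1)` (with the previous line: `Z(2,1,1) = Z(4)`).

References: M. Kaneko, S. Yamamoto, arXiv:1605.03117 Thm 4.1, Thm 4.6, Prop. 5.4;
Kontsevich–Zagier 2001 §1.2.
-/

noncomputable section

open Literature.NumberTheory.Transcendental Literature.NumberTheory.Transcendental.KZ

namespace Summit.KontsevichZagierPeriods.KontsevichZagierPeriods.Theorems

/-! ## 0. Shuffle form -/

/-- **THEOREM LIII in shuffle form.** For admissible `u` of weight `m + 1` and every `i`: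
`Σ_{w ∈ bw(u)⁻ ш 1^{i+1}} Z(0 :: w) = Σ_{v ∈ HookWords u 0 (i+1)} Z(v)` in `𝒫` — the integral side
of Kaneko–Yamamoto's integral-series identity for `(u; 1^{i+1})` equals its series side, by the
three rules alone. -/
theorem soloInformed_hook_identity_shuffle {m : ℕ} {u : List ℕ} {k : ℕ} (hu : MZV.IsAdmissible u)
    (hw : MZV.weight u = m + 1) (hk : u.length = k + 1) (i : ℕ) :
    ((MZV.shuffleWord (MZV.binaryWord u).tail (List.replicate (i + 1) true)).map
        fun w => mzvClass (MZV.ofBinaryWord (false :: w))).sum =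
      ((soloInformedHookWords u 0 (i + 1)).map mzvClass).sum := by
  rw [← soloInformed_hook_sum_mzvClass_eq_shuffleWord hu hw]
  exact soloInformed_hook_identity hu hw hk i

/-! ## 1. Counting form -/

/-- The number of linear extensions of the hook poset `E(m,i)` along which `u` reads as `w`. -/
def soloInformedHookCount (u : List ℕ) (m i : ℕ) (w : List ℕ) : ℕ :=
  ((Finset.univ.filter (soloInformedCompat (soloInformedHookPoset m i))).filter
    fun σ => soloInformedHookIdxσ u m i σ = w).card

/-- **HOOK(u, i+1), counting form**: `Σ_{w ∈ T} #{σ ⊨ E | idx_σ = w} · Z(w) = Σ HookWords-classes`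
for any `T` listing the words read along the linear extensions. -/
theorem soloInformed_hook_identity_count {m i : ℕ} {u : List ℕ} {k : ℕ} (hu : MZV.IsAdmissible u)
    (hw : MZV.weight u = m + 1) (hk : u.length = k + 1) {T : Finset (List ℕ)}
    (hT : (Finset.univ.filter (soloInformedCompat (soloInformedHookPoset m i))).image
      (soloInformedHookIdxσ u m i) = T) :
    ∑ w ∈ T, soloInformedHookCount u m i w • mzvClass w =
      ((soloInformedHookWords u 0 (i + 1)).map mzvClass).sum := by
  rw [← soloInformed_hook_identity hu hw hk i, Finset.sum_comp mzvClass (soloInformedHookIdxσ u m i), hT]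
  rfl

/-! ## 2. Instances -/

/-- **HOOK((2), 1)**: `2·Z(2,1) = Z(2,1) + Z(3)` in `𝒫`. -/
theorem soloInformed_hook_inst_two_one :
    2 • mzvClass [2, 1] = mzvClass [2, 1] + mzvClass [3] := by
  have h := soloInformed_hook_identity_count (m := 1) (i := 0) (u := [2]) (k := 0) (by decide) rfl rfl
    (T := {[2, 1]}) (by decide)
  rw [Finset.sum_singleton, show soloInformedHookCount [2] 1 0 [2, 1] = 2 from by decide,
    show soloInformedHookWords [2] 0 1 = [[2, 1], [3]] from by decide] at h
  simpa [two_nsmul] using h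

/- Euler's identity `Z(2,1) = Z(3)` in `𝒫` follows from HOOK((2), 1) by cancelling one `Z(2,1)`;
it is already a tree theorem (`soloInformed_mzvClass_euler3`, file `SoloInformedZetaOneTwoClass`,
by the Möbius telescope), so it is not restated here. -/

/-- **HOOK((2), 2)**: `3·Z(2,1,1) = Z(2,1,1) + Z(2,2) + Z(3,1) + Z(4)` in `𝒫`. -/
theorem soloInformed_hook_inst_two_two :
    3 • mzvClass [2, 1, 1] = mzvClass [2, 1, 1] + mzvClass [2, 2] + mzvClass [3, 1] + mzvClass [4] := by
  have h := soloInformed_hook_identity_count (m := 1) (i := 1) (u := [2]) (k := 0) (by decide) rfl rfl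
    (T := {[2, 1, 1]}) (by decide)
  rw [Finset.sum_singleton, show soloInformedHookCount [2] 1 1 [2, 1, 1] = 3 from by decide,
    show soloInformedHookWords [2] 0 2 = [[2, 1, 1], [2, 2], [3, 1], [4]] from by decide] at h
  simpa [add_assoc] using h

/-- **HOOK((3), 1)**: `Z(2,2) + 2·Z(3,1) = Z(3,1) + Z(4)` in `𝒫`. -/
theorem soloInformed_hook_inst_three_one :
    mzvClass [2, 2] + 2 • mzvClass [3, 1] = mzvClass [3, 1] + mzvClass [4] := by
  have h := soloInformed_hook_identity_count (m := 2) (i := 0) (u := [3]) (k := 0) (by decide) rfl rfl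
    (T := {[2, 2], [3, 1]}) (by decide)
  rw [Finset.sum_pair (by decide), show soloInformedHookCount [3] 2 0 [2, 2] = 1 from by decide,
    show soloInformedHookCount [3] 2 0 [3, 1] = 2 from by decide,
    show soloInformedHookWords [3] 0 1 = [[3, 1], [4]] from by decide] at h
  simpa using h

/-- **`Z(2,2) + Z(3,1) = Z(4)` in `𝒫`**, read off HOOK((3), 1). -/
theorem soloInformed_hook_two_two_add_three_one :
    mzvClass [2, 2] + mzvClass [3, 1] = mzvClass [4] := by
  have h := soloInformed_hook_inst_three_one
  rw [two_nsmul] at h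
  linear_combination h

/-- **HOOK((2,1), 1)**: `3·Z(2,1,1) = 2·Z(2,1,1) + Z(2,2) + Z(3,1)` in `𝒫`. -/
theorem soloInformed_hook_inst_twoOne_one :
    3 • mzvClass [2, 1, 1] = 2 • mzvClass [2, 1, 1] + mzvClass [2, 2] + mzvClass [3, 1] := by
  have h := soloInformed_hook_identity_count (m := 2) (i := 0) (u := [2, 1]) (k := 1) (by decide) rfl rfl
    (T := {[2, 1, 1]}) (by decide)
  rw [Finset.sum_singleton, show soloInformedHookCount [2, 1] 2 0 [2, 1, 1] = 3 from by decide,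
    show soloInformedHookWords [2, 1] 0 1 = [[2, 1, 1], [3, 1], [2, 1, 1], [2, 2]] from by decide] at h
  simp only [List.map_cons, List.map_nil, List.sum_cons, List.sum_nil, add_zero] at h
  rw [h, two_nsmul]
  abel

/-- **`Z(2,1,1) = Z(2,2) + Z(3,1)` in `𝒫`** (read off HOOK((2,1), 1)); with
`soloInformed_hook_two_two_add_three_one`, `Z(2,1,1) = Z(4)`. -/
theorem soloInformed_hook_two_one_one :
    mzvClass [2, 1, 1] = mzvClass [2, 2] + mzvClass [3, 1] ∧ mzvClass [2, 1, 1] = mzvClass [4] := by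
  have h := soloInformed_hook_inst_twoOne_one
  have h4 := soloInformed_hook_two_two_add_three_one
  have h1 : mzvClass [2, 1, 1] = mzvClass [2, 2] + mzvClass [3, 1] := by
    simp only [succ_nsmul, zero_nsmul, zero_add] at h
    linear_combination h
  exact ⟨h1, h1.trans h4⟩

/-! ## 3. Kaneko–Yamamoto's form: `Z(μ(k,(1^{i+2}))) = Z(k ⊛ ((1^{i+2}))^★)` -/

/-- **THEOREM LIII in Kaneko–Yamamoto's form.** For an admissible index `u = a :: T` of weight
`m + 1` and `i + 1` bullets, in `𝒫`: the shuffle side — `Z` summed over the words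
`0 (bw(u)⁻ ш 1^{i+1})`, i.e. over the linear extensions of K–Y's 2-poset `μ(k, (1^{i+2}))` with
`k = (rev T, a − 1)` — equals the series side `Z(k ⊛ ((1^{i+2}))^★)`
`= Σ_{d ⊨ i+2} Σ_{v ∈ T ∗ d.tail} Z((a − 1 + d_1) :: v)` (file `HookSeries`, our orientation).
Every pair `(k, (1,…,1))` of K–Y's identity (4.1) arises (`k` non-empty arbitrary).
[Kaneko–Yamamoto 2018 = arXiv:1605.03117, Thm 4.1 with `l = (1,…,1)`; here from the three rules] -/
theorem soloInformed_KY_integral_series_ones {m a : ℕ} {T : List ℕ}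
    (hu : MZV.IsAdmissible (a :: T)) (hw : MZV.weight (a :: T) = m + 1) (i : ℕ) :
    ((MZV.shuffleWord (MZV.binaryWord (a :: T)).tail (List.replicate (i + 1) true)).map
        fun w => mzvClass (MZV.ofBinaryWord (false :: w))).sum =
      ((soloInformedComp (i + 2)).map fun d =>
        ((MZV.stuffle T d.tail).map fun v => mzvClass ((a - 1 + d.headI) :: v)).sum).sum := by
  have ha : 1 ≤ a := by
    have h2 := hu.2 (List.cons_ne_nil a T)
    simp only [List.head_cons] at h2
    omega
  rw [soloInformed_hook_identity_shuffle hu hw (rfl : (a :: T).length = T.length + 1) i]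
  exact soloInformed_hookWords_series_KY ha T (i + 1) mzvClass

end Summit.KontsevichZagierPeriods.KontsevichZagierPeriods.Theorems
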